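import Literature.Computability.Complexity.PromiseZPP
import Literature.Computability.Complexity.ProbabilisticClassesProofs
import HarnessLib

/-!
# `PromiseP ⊆ PromiseZPP' ⊆ PromiseBPP'` (proofs; trunk CplxCore)

Sibling proof file of `PromiseZPP.lean` (D-0014), announced there: the inclusions among the
*textbook* promise classes of `Promise.lean` / `PromiseZPP.lean`

* `PromiseP_subset_PromiseRP'`, `PromiseP_subset_PromiseCoRP'`, `PromiseP_subset_PromiseZPP'` —
  ignore the coins (Gill 1977, Prop. 5.1; Goldreich 2006, §6.2);
* `swap_mem_PromiseBPP'_iff` — promise-`BPP` is closed under exchanging yes/no (complement the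
  witness language, `co P = P`; Arora–Barak 2009, §7.1);
* `PromiseRP'_subset_PromiseBPP'` — two independent runs on the two halves of `2p(n)` coins, accept
  if either accepts (Arora–Barak 2009, §7.3; Gill 1977, Thm. 6.5), verbatim the argument of
  `RP_subset_BPP_holds` (`ProbabilisticClassesProofs.lean`: witness
  `(truncSndFn p)⁻¹ L' ⊔ (dropSndFn p)⁻¹ L' ∈ P`, product rule `cnt_take_drop`), applied to the
  yes- and no-promise separately;
* `PromiseCoRP'_subset_PromiseBPP'` (by `swap`), `PromiseZPP'_subset_PromiseBPP'`;
* `ofLanguage_mem_PromiseBPP'_iff` — on a trivial promise the textbook promise-`BPP` is `BPP`, and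
  the discharge `PromiseBPP_subset_PromiseBPP'_holds` of the named fact of `Promise.lean` (the strong
  lift `promiseLift BPP` is contained in the textbook class);
* `promiseLift_anti` — restricting the promise preserves membership (Goldreich 2006, §6.1),
  companion of `PromiseRP'.anti` / `PromiseZPP'.anti` (for `PromiseBPP'` this is
  `Literature.Computability.Cryptography.mem_PromiseBPP'_of_subset`, `LatticeOWF.lean`).

These are the inclusions `Promise-P ⊆ Promise-ZPP ⊆ Promise-BPP` used when Hirahara's
`Gap MINKT ∈ Promise-ZPP` (FOCS 2018 / ECCC TR18-138, Cor. 4.22) is combined with a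
derandomisation hypothesis `Promise-BPP = Promise-P` (ibid., Cor. 4.23)
(`Literature/Computability/MetaComplexity/GapMINKTProofs.lean`).

## References

* O. Goldreich, *On promise problems: a survey*, LNCS 3895 (2006) 254–290, §1.2 Def. 2, §6.2.
* J. Gill, *Computational complexity of probabilistic Turing machines*, SIAM J. Comput. 6 (1977),
  Prop. 5.1, Thm. 6.5.
* S. Arora, B. Barak, *Computational Complexity: A Modern Approach*, CUP 2009, §7.1, §7.3.
-/

namespace Literature.Computability.Complexity

open _root_.Computability Polynomial

/-! ### `PromiseP ⊆ PromiseZPP'` -/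

/-- **`PromiseP ⊆ PromiseRP'`**: a separating language `L ∈ P` gives the witness
`{w | (boolUnpair w).1 ∈ L} ∈ P` with `0` coins; on a yes-instance every coin string accepts, on a
no-instance none does. [cite: Gill1977, Prop. 5.1] -/
theorem PromiseP_subset_PromiseRP' : PromiseP ⊆ PromiseRP' := by
  rintro Q ⟨L, hL, hyes, hno⟩
  set L' : Language Bool := {w | (boolUnpair w).1 ∈ L} with hL'
  refine ⟨L', P_closed_boolUnpair_fst L hL, 0, fun x hx => ?_, fun x hx y _ => ?_⟩
  · have hset : {y : List Bool | boolPair x y ∈ L'} = Set.univ := by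
      refine Set.eq_univ_of_forall fun y => ?_
      change (boolUnpair (boolPair x y)).1 ∈ L
      rw [boolUnpair_boolPair]
      exact hyes hx
    rw [hset, uniformProb_univ]
    norm_num
  · change (boolUnpair (boolPair x y)).1 ∉ L
    rw [boolUnpair_boolPair]
    exact fun h => hno hx h

/-- `PromiseP` is closed under `swap` (complement the separating language, `co P = P`).
[cite: Goldreich2006, §5.1] -/
theorem swap_mem_PromiseP {Q : PromiseProblem} (h : Q ∈ PromiseP) : Q.swap ∈ PromiseP := by
  obtain ⟨L, hL, hyes, hno⟩ := h
  refine ⟨Lᶜ, compl_mem_P_iff.2 hL, hno, ?_⟩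
  change Q.yes ≤ Lᶜᶜ
  rw [compl_compl]
  exact hyes

/-- **`PromiseP ⊆ PromiseCoRP'`** (apply `PromiseP_subset_PromiseRP'` to the swapped problem).
[cite: Goldreich2006, §6.2] -/
theorem PromiseP_subset_PromiseCoRP' : PromiseP ⊆ PromiseCoRP' :=
  fun _ h => PromiseP_subset_PromiseRP' (swap_mem_PromiseP h)

/-- **`PromiseP ⊆ PromiseZPP'`** (`Promise-P ⊆ Promise-ZPP`). [cite: Gill1977, Prop. 5.1] -/
theorem PromiseP_subset_PromiseZPP' : PromiseP ⊆ PromiseZPP' :=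
  fun _ h => ⟨PromiseP_subset_PromiseRP' h, PromiseP_subset_PromiseCoRP' h⟩

/-! ### `swap` and `PromiseBPP'` -/

/-- Promise-`BPP` is symmetric under exchanging yes- and no-instances: replace the witness
language `L'` by `L'ᶜ ∈ P`; the events "`⟨x,y⟩ ∈ L'ᶜ`" and "`⟨x,y⟩ ∉ L'`" coincide.
[cite: AroraBarak2009, §7.1] -/
theorem swap_mem_PromiseBPP' {Q : PromiseProblem} (h : Q ∈ PromiseBPP') : Q.swap ∈ PromiseBPP' := by
  obtain ⟨L', hL', p, hyes, hno⟩ := h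
  refine ⟨L'ᶜ, compl_mem_P_iff.2 hL', p, fun x hx => hno x hx, fun x hx => ?_⟩
  have hset : {y : List Bool | boolPair x y ∉ L'ᶜ} = {y | boolPair x y ∈ L'} := by
    ext y
    change ¬ ¬ boolPair x y ∈ L' ↔ boolPair x y ∈ L'
    exact not_not
  change 2 / 3 ≤ uniformProb (p.eval x.length) {y : List Bool | boolPair x y ∉ L'ᶜ}
  rw [hset]
  exact hyes x hx

/-- `Q.swap ∈ PromiseBPP' ↔ Q ∈ PromiseBPP'`. [cite: AroraBarak2009, §7.1] -/
@[simp] theorem swap_mem_PromiseBPP'_iff {Q : PromiseProblem} :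
    Q.swap ∈ PromiseBPP' ↔ Q ∈ PromiseBPP' :=
  ⟨fun h => by simpa using swap_mem_PromiseBPP' h, swap_mem_PromiseBPP'⟩

/-! ### `PromiseRP' ⊆ PromiseBPP'`: two independent runs -/

/-- **`PromiseRP' ⊆ PromiseBPP'`** (`Promise-RP ⊆ Promise-BPP`): run the one-sided machine twice on
the two halves of `2p(n)` independent coins and accept if either run accepts — witness language
`(truncSndFn p)⁻¹(L') ⊔ (dropSndFn p)⁻¹(L') ∈ P`. On a yes-instance the rejecting coin strings
number `(2^m - a)^2 ≤ 4^m/4` (`a ≥ 2^{m-1}` accepting strings of length `m`, product rule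
`cnt_take_drop`), so the acceptance probability is `≥ 3/4 ≥ 2/3`; on a no-instance no coin string
of length `2m` accepts, so the rejection probability is `1`. This is `RP_subset_BPP_holds` with the
two promise clauses treated separately. [cite: AroraBarak2009, §7.3] -/
theorem PromiseRP'_subset_PromiseBPP' : PromiseRP' ⊆ PromiseBPP' := by
  rintro Q ⟨L', hL', p, hyesQ, hnoQ⟩
  set W : Language Bool := truncSndFn p ⁻¹' L' ⊔ dropSndFn p ⁻¹' L' with hW
  have hWP : W ∈ Classes.P :=
    union_mem_P (preimage_mem_P hL' (truncSndFn_mem_FP p)) (preimage_mem_P hL' (dropSndFn_mem_FP p))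
  have hmemW : ∀ x y : List Bool, boolPair x y ∈ W ↔
      boolPair x (y.take (p.eval x.length)) ∈ L' ∨ boolPair x (y.drop (p.eval x.length)) ∈ L' :=
    fun x y => by
      change truncSndFn p (boolPair x y) ∈ L' ∨ dropSndFn p (boolPair x y) ∈ L' ↔ _
      rw [truncSndFn_boolPair, dropSndFn_boolPair]
  have hm2 : ∀ x : List Bool, (2 * p : ℕ[X]).eval x.length = p.eval x.length + p.eval x.length :=
    fun x => by simp; ring
  refine ⟨W, hWP, 2 * p, fun x hx => ?_, fun x hx => ?_⟩
  · -- yes-instance: accepting strings have prefix or suffix in `E`; complement by the product rule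
    have hmemx : ∀ y : List Bool, boolPair x y ∈ W ↔
        boolPair x (y.take (p.eval x.length)) ∈ L' ∨ boolPair x (y.drop (p.eval x.length)) ∈ L' :=
      hmemW x
    have hpx := hyesQ x hx
    clear hmemW hyesQ hnoQ
    rw [hm2 x, uniformProb_eq_cnt_div, le_div_iff₀ (by positivity)]
    rw [uniformProb_eq_cnt_div, le_div_iff₀ (by positivity)] at hpx
    generalize hm : p.eval x.length = m at *
    set E : Set (List Bool) := {c | boolPair x c ∈ L'} with hE
    have ha : 2 ^ m ≤ 2 * cnt m E := by
      have h' : ((2 ^ m : ℕ) : ℝ) ≤ ((2 * cnt m E : ℕ) : ℝ) := by push_cast; linarith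
      exact_mod_cast h'
    have hset : {y : List Bool | boolPair x y ∈ W} = {y | y.take m ∈ E ∨ y.drop m ∈ E} := by
      ext y; simp only [Set.mem_setOf_eq, hmemx, hE]
    have hcompl : cnt (m + m) {y : List Bool | y.take m ∈ E ∨ y.drop m ∈ E} +
        cnt (m + m) {y : List Bool | y.take m ∈ Eᶜ ∧ y.drop m ∈ Eᶜ} = 2 ^ (m + m) := by
      rw [← cnt_add_cnt_compl (m + m) {y : List Bool | y.take m ∈ E ∨ y.drop m ∈ E}]
      congr 1
      exact cnt_congr fun y _ => by simp [not_or]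
    have hprod := cnt_take_drop m m Eᶜ Eᶜ
    have hEc := cnt_add_cnt_compl m E
    rw [hset]
    -- integer arithmetic: t = 2^m, a = cnt m E, b = t - a with 2b ≤ t
    have key : 2 * 2 ^ (m + m) ≤ 3 * cnt (m + m) {y : List Bool | y.take m ∈ E ∨ y.drop m ∈ E} := by
      rw [hprod] at hcompl
      have hpow : (2 : ℕ) ^ (m + m) = 2 ^ m * 2 ^ m := pow_add 2 m m
      nlinarith [hcompl, hEc, ha, hpow, Nat.zero_le (cnt m Eᶜ), Nat.zero_le (cnt m E)]
    have key' : ((2 * 2 ^ (m + m) : ℕ) : ℝ) ≤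
        ((3 * cnt (m + m) {y : List Bool | y.take m ∈ E ∨ y.drop m ∈ E} : ℕ) : ℝ) := by
      exact_mod_cast key
    push_cast at key'
    linarith
  · -- no-instance: no accepting string of length `m`, so every coin string of length `2m` rejects
    have hmemx : ∀ y : List Bool, boolPair x y ∈ W ↔
        boolPair x (y.take (p.eval x.length)) ∈ L' ∨ boolPair x (y.drop (p.eval x.length)) ∈ L' :=
      hmemW x
    have hneg := hnoQ x hx
    clear hmemW hyesQ hnoQ
    rw [hm2 x, uniformProb_eq_cnt_div, le_div_iff₀ (by positivity)]
    generalize hm : p.eval x.length = m at *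
    have hall : cnt (m + m) {y : List Bool | boolPair x y ∉ W} = 2 ^ (m + m) :=
      cnt_eq_two_pow_of_forall fun y hy => by
        simp only [Set.mem_setOf_eq, hmemx, not_or]
        exact ⟨hneg _ (by rw [List.length_take]; omega), hneg _ (by rw [List.length_drop]; omega)⟩
    rw [hall]
    push_cast
    nlinarith [pow_pos (show (0 : ℝ) < 2 by norm_num) (m + m)]

/-- **`PromiseCoRP' ⊆ PromiseBPP'`** (`Promise-coRP ⊆ Promise-BPP`): by `swap`.
[cite: AroraBarak2009, §7.3] -/
theorem PromiseCoRP'_subset_PromiseBPP' : PromiseCoRP' ⊆ PromiseBPP' :=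
  fun _ h => swap_mem_PromiseBPP'_iff.1 (PromiseRP'_subset_PromiseBPP' h)

/-- **`PromiseZPP' ⊆ PromiseBPP'`** (`Promise-ZPP ⊆ Promise-BPP`), the inclusion under which a
derandomisation `Promise-BPP = Promise-P` collapses `Promise-ZPP` as well (Hirahara 2018,
Cor. 4.22 ⇒ Cor. 4.23). [cite: Gill1977, Thm. 6.5] -/
theorem PromiseZPP'_subset_PromiseBPP' : PromiseZPP' ⊆ PromiseBPP' :=
  fun _ h => PromiseRP'_subset_PromiseBPP' h.1

/-- Hence `PromiseP ⊆ PromiseBPP'` for the textbook promise-`BPP` (cf. the strong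
`PromiseBPP = promiseLift BPP`, for which this is `promiseLift_mono P_subset_BPP`).
[cite: Gill1977, Prop. 5.1] -/
theorem PromiseP_subset_PromiseBPP' : PromiseP ⊆ PromiseBPP' :=
  PromiseP_subset_PromiseZPP'.trans PromiseZPP'_subset_PromiseBPP'

/-! ### Trivial promises and the strong lift -/

/-- On a language (trivial promise) the textbook promise-`BPP` is `BPP`:
`ofLanguage L ∈ PromiseBPP' ↔ L ∈ BPP` (on `x ∈ L` the event "correct verdict" is "accept", on
`x ∉ L` it is "reject"). [cite: Goldreich2006, §1.2 (Def. 2)] -/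
@[simp] theorem ofLanguage_mem_PromiseBPP'_iff {L : Language Bool} :
    PromiseProblem.ofLanguage L ∈ PromiseBPP' ↔ L ∈ BPP := by
  have hyesSet : ∀ (L' : Language Bool) (x : List Bool), x ∈ L →
      {y : List Bool | boolPair x y ∈ L' ↔ x ∈ L} = {y | boolPair x y ∈ L'} := fun L' x hx => by
    ext y; simp [hx]
  have hnoSet : ∀ (L' : Language Bool) (x : List Bool), x ∉ L →
      {y : List Bool | boolPair x y ∈ L' ↔ x ∈ L} = {y | boolPair x y ∉ L'} := fun L' x hx => by
    ext y; simp [hx]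
  constructor
  · rintro ⟨L', hL', p, hyes, hno⟩
    refine ⟨L', hL', p, fun x => ?_⟩
    by_cases hx : x ∈ L
    · rw [hyesSet L' x hx]; exact hyes x hx
    · rw [hnoSet L' x hx]; exact hno x hx
  · rintro ⟨L', hL', p, h⟩
    refine ⟨L', hL', p, fun x hx => ?_, fun x hx => ?_⟩
    · have hx' : x ∈ L := hx
      rw [← hyesSet L' x hx']; exact h x
    · have hx' : x ∉ L := hx
      rw [← hnoSet L' x hx']; exact h x

/-- **Discharge of `PromiseBPP_subset_PromiseBPP'`** (`Promise.lean`): a `BPP` language `L`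
separating `Q` has a `2/3`-correct witness on *every* input; on `Q.yes ⊆ L` correctness is
acceptance and on `Q.no ⊆ Lᶜ` it is rejection. [cite: Goldreich2006, §1.2 (Def. 2)] -/
theorem PromiseBPP_subset_PromiseBPP'_holds : PromiseBPP_subset_PromiseBPP' := by
  rintro Q ⟨L, ⟨L', hL', p, h⟩, hyes, hno⟩
  refine ⟨L', hL', p, fun x hx => ?_, fun x hx => ?_⟩
  · have hx' : x ∈ L := hyes hx
    have hset : {y : List Bool | boolPair x y ∈ L'} = {y | boolPair x y ∈ L' ↔ x ∈ L} := by
      ext y; simp [hx']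
    rw [hset]; exact h x
  · have hx' : x ∉ L := fun h' => hno hx h'
    have hset : {y : List Bool | boolPair x y ∉ L'} = {y | boolPair x y ∈ L' ↔ x ∈ L} := by
      ext y; simp [hx']
    rw [hset]; exact h x

/-! ### Restricting the promise -/

/-- A separating language of `Q` separates every special case of `Q`: if `Q'.yes ⊆ Q.yes` and
`Q'.no ⊆ Q.no` then `Q ∈ promiseLift C → Q' ∈ promiseLift C` (in particular for `PromiseP`).
[cite: Goldreich2006, §6.1 (any solver also solves the special cases)] -/
theorem promiseLift_anti {C : Set (Language Bool)} {Q Q' : PromiseProblem} (hyes : Q'.yes ≤ Q.yes)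
    (hno : Q'.no ≤ Q.no) (h : Q ∈ promiseLift C) : Q' ∈ promiseLift C := by
  obtain ⟨L, hL, hy, hn⟩ := h
  exact ⟨L, hL, hyes.trans hy, hno.trans hn⟩

end Literature.Computability.Complexity
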